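import Summits.AtomisticToContinuum.Crystallization.Theorems.FrustratedLawDichotomyStrainedPatchHomEntrySemanticCells

/-!
# Strained patch, `(H)` certificates — k-d CUT TREES WITH ARBITRARY INTEGER CUTS and the MANIFEST FOLD: one kernel `decide` turns a partition manifest of
# a box plus the list of landed cell facts into the semantic root fact `semOKH μ c w = true` (27623 `(H) HomFloor`, hcp half; decomp-a2c hand 2, generation 39)

Critic row 1467 (D3)/(D5): the 27623-H root fact of record is the ONE Boolean `semOKH (−399232847967326) rootCH rootWH = true` (consumer of record
`…RecordJunctionHomFloorF6p.aperiodicFrustratedLawGap_of_entryTree6RBKP4_semOKH_fallbackLever_rim_A35000_T22_record`), to be assembled from sheet-centred cells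
by «the mechanical fold `semOKH_of_cut` / `semOKH_anti_box` over the PARTITION MANIFEST … coverage by construction».  hand-1 g39's `…HomEntrySemantic` types the
BINARY glue (`semOKH_of_cut`: one coordinate, one integer cut point, pieces as `Function.update` literals) and the sub-box rule (`semOKH_anti_box`); the
certificate trees of the lane (`…HomCertTree.treeOK`) cut at MIDPOINTS only.  This module types the n-ary fold once and for all:

* §1 `CutTree κ α` — a k-d CUT TREE: a node `cut k u l r` cuts coordinate `k` of the box `[c_k − w_k, c_k + w_k]` at the scaled-integer point `p = c_k − w_k + 2u`
  into the LEFT piece (centre `c_k − w_k + u`, half-width `u`) and the RIGHT piece (centre `c_k + u`, half-width `w_k − u`) — exact integer arithmetic, no parity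
  condition, arbitrary `u`; leaves carry a label `a : α` (e.g. an index into the manifest's list of certified boxes).  `cutOK leafOK t c w : Bool` runs a
  COMPUTABLE leaf test down the tree (kernel `decide`); `cutOK_sound`: for ANY verdict `V` closed under the cut, `cutOK leafOK t c w = true → V c w = true`
  as soon as every accepted leaf implies `V`;  `CutTree.leafCount` for the coverage ledger.
* §2 the leaf test of a MANIFEST: `coveredAt L i c w` = «the leaf box `(c, w)` is contained, endpoint-wise on every coordinate, in the listed box `L[i]`»
  (`boxContains`, decidable); `cutOK_coveredAt_sound`: for `V` anti-box and closed under cuts, `(∀ b ∈ L, V b.1 b.2 = true) → cutOK (coveredAt L) t c w = true →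
  V c w = true`.  COVERAGE IS BY CONSTRUCTION: the kernel checks that the leaves of `t` partition `(c, w)` (they do, by the cut arithmetic) and that each lies in a
  listed box; the list facts are the landed cell theorems.
* §3 ★★★ the hcp semantic instance: `semOKH_cut` (hand-1's `semOKH_of_cut` in `(k, u)` form), `semOKH_of_cutOK` and
  `semOKH_root_of_manifest : (∀ b ∈ L, semOKH μ b.1 b.2 = true) → cutOK (coveredAt L) t rootCH rootWH = true → semOKH μ rootCH rootWH = true`;
  ★ and the KERNEL-LEAF variant `semOKH_of_cutOK_HT4A2QQDCRS3` / `…4`: a cut tree whose leaves are checked DIRECTLY by the production verdict v3 / v4 (so a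
  production certificate may cut at arbitrary integer points — around the sheet-centred natural cells — instead of dyadic midpoints; `treeOK` is the special case).
* §4 list plumbing for the manifest facts (`semFacts_nil/cons/append`) and §5 a SMOKE on production literals: the landed `G70` cell re-derived from a 3-leaf cut tree
  (hand-1's non-midpoint `ξ₁` cut `u = 495416258234` of `…SemanticCells` §3, then a second cut) by ONE `decide` + the one-element manifest `[(cG70, wG70)]`.

MANIFEST FORMAT fixed hereby (critic (D5)): the tree in preorder, node = `(k, u)` (coordinate, left half-width; cut point `c_k − w_k + 2u` of the CURRENT node box),
leaf = index `i` into the list `L` of certified boxes `(centre, half-width)`; the root proof is `semOKH_root_of_manifest L hL t (by decide)`.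
One inductive type + five small computable definitions (`cutOK`, `CutTree.leafCount`, `boxContains`, `coveredAt`, smoke data); 0 sorry; standard axioms; no
instances / notation / `native_decide`.  `--supports stmt-AtomisticToContinuum-27623`.  [formal bookkeeping]
-/

namespace Summit.AtomisticToContinuum.Crystallization.Theorems.FrustratedLawDichotomyStrainedPatchHomCutTree

open Summit.AtomisticToContinuum.Crystallization.Theorems.FrustratedLawDichotomyStrainedPatchHomCertTree (CertTree treeOK)
open Summit.AtomisticToContinuum.Crystallization.Theorems.FrustratedLawDichotomyStrainedPatchHomEntryGramHcp (rootCH rootWH)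
open Summit.AtomisticToContinuum.Crystallization.Theorems.FrustratedLawDichotomyStrainedPatchHomEntryLeafHT (semOKH semOKH_anti_box semOKH_of_cut
  entryLeafOKHT4A2QQDCRS3 entryLeafOKHT4A2QQDCRS4 semOKH_of_HT4A2QQDCRS3 semOKH_of_HT4A2QQDCRS4 semOKH_mono_level cG70 wG70 sem78_G70)

/-! ## §1 Cut trees with arbitrary integer cuts, and their soundness for any cut-closed verdict -/

/-- **k-d CUT TREE.**  `leaf a` — a leaf with label `a`; `cut k u l r` — cut coordinate `k` of the node box `[c_k − w_k, c_k + w_k]` at `c_k − w_k + 2u`: left child box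
(centre `c_k − w_k + u`, half-width `u`), right child box (centre `c_k + u`, half-width `w_k − u`), all other coordinates unchanged. -/
inductive CutTree (κ α : Type) where
  | leaf : α → CutTree κ α
  | cut : κ → ℤ → CutTree κ α → CutTree κ α → CutTree κ α

variable {κ α : Type}

/-- Number of leaves of a cut tree (the denominator of the coverage ledger). -/
def CutTree.leafCount : CutTree κ α → ℕ
  | .leaf _ => 1
  | .cut _ _ l r => l.leafCount + r.leafCount

section CutTrees
variable [DecidableEq κ]

/-- **Run a leaf test down a cut tree** (computable; boxes in scaled integers, centre `c`, half-widths `w`). -/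
def cutOK (leafOK : α → (κ → ℤ) → (κ → ℤ) → Bool) : CutTree κ α → (κ → ℤ) → (κ → ℤ) → Bool
  | .leaf a, c, w => leafOK a c w
  | .cut k u l r, c, w =>
      cutOK leafOK l (Function.update c k (c k - w k + u)) (Function.update w k u) &&
        cutOK leafOK r (Function.update c k (c k + u)) (Function.update w k (w k - u))

/-- Unfolding a leaf. [formal bookkeeping] -/
theorem cutOK_leaf (leafOK : α → (κ → ℤ) → (κ → ℤ) → Bool) (a : α) (c w : κ → ℤ) : cutOK leafOK (.leaf a) c w = leafOK a c w := rfl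

/-- Unfolding a cut. [formal bookkeeping] -/
theorem cutOK_cut (leafOK : α → (κ → ℤ) → (κ → ℤ) → Bool) (k : κ) (u : ℤ) (l r : CutTree κ α) (c w : κ → ℤ) :
    cutOK leafOK (.cut k u l r) c w =
      (cutOK leafOK l (Function.update c k (c k - w k + u)) (Function.update w k u) &&
        cutOK leafOK r (Function.update c k (c k + u)) (Function.update w k (w k - u))) := rfl

/-- ★ **SOUNDNESS OF CUT TREES for any verdict closed under cuts**: if every accepted leaf implies `V` and `V` glues along every cut, then an accepted tree certifies its
root box. [formal bookkeeping: induction on the tree] -/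
theorem cutOK_sound (V : (κ → ℤ) → (κ → ℤ) → Bool) (leafOK : α → (κ → ℤ) → (κ → ℤ) → Bool)
    (hleaf : ∀ (a : α) (c w : κ → ℤ), leafOK a c w = true → V c w = true)
    (hcut : ∀ (k : κ) (u : ℤ) (c w : κ → ℤ), V (Function.update c k (c k - w k + u)) (Function.update w k u) = true →
      V (Function.update c k (c k + u)) (Function.update w k (w k - u)) = true → V c w = true) :
    ∀ (t : CutTree κ α) (c w : κ → ℤ), cutOK leafOK t c w = true → V c w = true
  | .leaf a, c, w, h => hleaf a c w h
  | .cut k u l r, c, w, h => by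
    simp only [cutOK, Bool.and_eq_true] at h
    exact hcut k u c w (cutOK_sound V leafOK hleaf hcut l _ _ h.1) (cutOK_sound V leafOK hleaf hcut r _ _ h.2)

end CutTrees

/-! ## §2 The leaf test of a manifest: containment in a listed certified box -/

section Manifest
variable [Fintype κ]

/-- `(c, w)` is contained in the box `b = (centre, half-width)`: `b.1 k − b.2 k ≤ c k − w k` and `c k + w k ≤ b.1 k + b.2 k` on every coordinate (decidable). -/
def boxContains (b : (κ → ℤ) × (κ → ℤ)) (c w : κ → ℤ) : Bool :=
  decide (∀ k, b.1 k - b.2 k ≤ c k - w k ∧ c k + w k ≤ b.1 k + b.2 k)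

/-- Specification of `boxContains`. [formal bookkeeping] -/
theorem boxContains_spec {b : (κ → ℤ) × (κ → ℤ)} {c w : κ → ℤ} (h : boxContains b c w = true) :
    ∀ k, b.1 k - b.2 k ≤ c k - w k ∧ c k + w k ≤ b.1 k + b.2 k :=
  of_decide_eq_true h

/-- **THE MANIFEST LEAF TEST**: leaf label `i` = an index into the list `L` of certified boxes; the leaf box must be contained in `L[i]` (out-of-range index: reject). -/
def coveredAt (L : List ((κ → ℤ) × (κ → ℤ))) (i : ℕ) (c w : κ → ℤ) : Bool :=
  match L[i]? with
  | some b => boxContains b c w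
  | none => false

/-- Label-free variant: the leaf box is contained in SOME listed box. -/
def coveredBy (L : List ((κ → ℤ) × (κ → ℤ))) (_ : Unit) (c w : κ → ℤ) : Bool :=
  L.any fun b => boxContains b c w

/-- A leaf accepted by `coveredAt L` is certified, for `V` anti-box and every listed box certified. [formal bookkeeping] -/
theorem coveredAt_sound (V : (κ → ℤ) → (κ → ℤ) → Bool)
    (hanti : ∀ (c w c' w' : κ → ℤ), (∀ k, c k - w k ≤ c' k - w' k ∧ c' k + w' k ≤ c k + w k) → V c w = true → V c' w' = true)
    (L : List ((κ → ℤ) × (κ → ℤ))) (hL : ∀ b ∈ L, V b.1 b.2 = true) :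
    ∀ (i : ℕ) (c w : κ → ℤ), coveredAt L i c w = true → V c w = true := by
  intro i c w h
  unfold coveredAt at h
  split at h
  · rename_i b hb
    exact hanti b.1 b.2 c w (boxContains_spec h) (hL b (List.mem_of_getElem? hb))
  · exact absurd h Bool.false_ne_true

/-- A leaf accepted by `coveredBy L` is certified, likewise. [formal bookkeeping] -/
theorem coveredBy_sound (V : (κ → ℤ) → (κ → ℤ) → Bool)
    (hanti : ∀ (c w c' w' : κ → ℤ), (∀ k, c k - w k ≤ c' k - w' k ∧ c' k + w' k ≤ c k + w k) → V c w = true → V c' w' = true)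
    (L : List ((κ → ℤ) × (κ → ℤ))) (hL : ∀ b ∈ L, V b.1 b.2 = true) :
    ∀ (a : Unit) (c w : κ → ℤ), coveredBy L a c w = true → V c w = true := by
  intro _ c w h
  obtain ⟨b, hb, hbc⟩ := List.any_eq_true.1 h
  exact hanti b.1 b.2 c w (boxContains_spec hbc) (hL b hb)

variable [DecidableEq κ]

/-- ★★ **THE MANIFEST FOLD (generic)**: for a verdict `V` that is anti-box and closed under cuts, a cut tree over the leaf test `coveredAt L` with every listed box certified
certifies its root box.  Coverage is by construction (the leaves of a cut tree partition the root box). [formal bookkeeping] -/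
theorem cutOK_coveredAt_sound (V : (κ → ℤ) → (κ → ℤ) → Bool)
    (hanti : ∀ (c w c' w' : κ → ℤ), (∀ k, c k - w k ≤ c' k - w' k ∧ c' k + w' k ≤ c k + w k) → V c w = true → V c' w' = true)
    (hcut : ∀ (k : κ) (u : ℤ) (c w : κ → ℤ), V (Function.update c k (c k - w k + u)) (Function.update w k u) = true →
      V (Function.update c k (c k + u)) (Function.update w k (w k - u)) = true → V c w = true)
    (L : List ((κ → ℤ) × (κ → ℤ))) (hL : ∀ b ∈ L, V b.1 b.2 = true) :
    ∀ (t : CutTree κ ℕ) (c w : κ → ℤ), cutOK (coveredAt L) t c w = true → V c w = true :=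
  cutOK_sound V (coveredAt L) (coveredAt_sound V hanti L hL) hcut

/-- The label-free manifest fold. [formal bookkeeping] -/
theorem cutOK_coveredBy_sound (V : (κ → ℤ) → (κ → ℤ) → Bool)
    (hanti : ∀ (c w c' w' : κ → ℤ), (∀ k, c k - w k ≤ c' k - w' k ∧ c' k + w' k ≤ c k + w k) → V c w = true → V c' w' = true)
    (hcut : ∀ (k : κ) (u : ℤ) (c w : κ → ℤ), V (Function.update c k (c k - w k + u)) (Function.update w k u) = true →
      V (Function.update c k (c k + u)) (Function.update w k (w k - u)) = true → V c w = true)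
    (L : List ((κ → ℤ) × (κ → ℤ))) (hL : ∀ b ∈ L, V b.1 b.2 = true) :
    ∀ (t : CutTree κ Unit) (c w : κ → ℤ), cutOK (coveredBy L) t c w = true → V c w = true :=
  cutOK_sound V (coveredBy L) (coveredBy_sound V hanti L hL) hcut

end Manifest

/-! ## §3 ★★★ The hcp semantic instance: the root fact from a manifest; kernel-leaf cut trees over v3 / v4 -/

/-- hand-1's `semOKH_of_cut` in `(k, u)` form: the two pieces of the cut `c_k − w_k + 2u` glue. [formal bookkeeping] -/
theorem semOKH_cut {μ : ℤ} (k : (Fin 3 × Fin 3) ⊕ Fin 3) (u : ℤ) (c w : (Fin 3 × Fin 3) ⊕ Fin 3 → ℤ)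
    (hl : semOKH μ (Function.update c k (c k - w k + u)) (Function.update w k u) = true)
    (hr : semOKH μ (Function.update c k (c k + u)) (Function.update w k (w k - u)) = true) : semOKH μ c w = true :=
  semOKH_of_cut k (a := c k - w k + u) (b := u) (a' := c k + u) (b' := w k - u) (by ring) (by ring) (by ring) rfl rfl rfl rfl hl hr

/-- ★★ **A MANIFEST CERTIFIES ITS ROOT BOX in the hcp semantic currency**: every listed box semantically certified at level `μ` + `cutOK (coveredAt L) t c w = true` (kernel
`decide`) ⟹ `semOKH μ c w = true`. [formal bookkeeping] -/
theorem semOKH_of_cutOK {μ : ℤ} (L : List (((Fin 3 × Fin 3) ⊕ Fin 3 → ℤ) × ((Fin 3 × Fin 3) ⊕ Fin 3 → ℤ))) (hL : ∀ b ∈ L, semOKH μ b.1 b.2 = true) :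
    ∀ (t : CutTree ((Fin 3 × Fin 3) ⊕ Fin 3) ℕ) (c w : (Fin 3 × Fin 3) ⊕ Fin 3 → ℤ), cutOK (coveredAt L) t c w = true → semOKH μ c w = true :=
  cutOK_coveredAt_sound (semOKH μ) (fun _ _ _ _ hc h => semOKH_anti_box hc h) (fun k u c w hl hr => semOKH_cut k u c w hl hr) L hL

/-- The label-free variant. [formal bookkeeping] -/
theorem semOKH_of_cutOK_coveredBy {μ : ℤ} (L : List (((Fin 3 × Fin 3) ⊕ Fin 3 → ℤ) × ((Fin 3 × Fin 3) ⊕ Fin 3 → ℤ)))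
    (hL : ∀ b ∈ L, semOKH μ b.1 b.2 = true) :
    ∀ (t : CutTree ((Fin 3 × Fin 3) ⊕ Fin 3) Unit) (c w : (Fin 3 × Fin 3) ⊕ Fin 3 → ℤ), cutOK (coveredBy L) t c w = true → semOKH μ c w = true :=
  cutOK_coveredBy_sound (semOKH μ) (fun _ _ _ _ hc h => semOKH_anti_box hc h) (fun k u c w hl hr => semOKH_cut k u c w hl hr) L hL

/-- ★★★ **THE 27623-H ROOT FACT OF RECORD FROM A PARTITION MANIFEST**: the list `L` of certified boxes (landed `sem78_*`-type facts) and a cut tree `t` of the root cube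
`(rootCH, rootWH)` whose every leaf lies in a listed box (ONE kernel `decide`) give `semOKH μ rootCH rootWH = true` — the `hHcp` of
`…RecordJunctionHomFloorF6p.aperiodicFrustratedLawGap_of_entryTree6RBKP4_semOKH_fallbackLever_rim_A35000_T22_record` at `μ = −399232847967326`. [formal bookkeeping] -/
theorem semOKH_root_of_manifest {μ : ℤ} (L : List (((Fin 3 × Fin 3) ⊕ Fin 3 → ℤ) × ((Fin 3 × Fin 3) ⊕ Fin 3 → ℤ)))
    (hL : ∀ b ∈ L, semOKH μ b.1 b.2 = true) (t : CutTree ((Fin 3 × Fin 3) ⊕ Fin 3) ℕ) (h : cutOK (coveredAt L) t rootCH rootWH = true) :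
    semOKH μ rootCH rootWH = true :=
  semOKH_of_cutOK L hL t rootCH rootWH h

/-- ★ **KERNEL-LEAF CUT TREES over the production verdict v3**: a cut tree (arbitrary integer cuts) whose leaves pass `entryLeafOKHT4A2QQDCRS3 μ` IN THE KERNEL certifies its
root box semantically — midpoint `treeOK` trees are the special case `u = w_k / 2`; cuts may now be laid around the sheet-centred cells. [formal bookkeeping] -/
theorem semOKH_of_cutOK_HT4A2QQDCRS3 {μ : ℤ} :
    ∀ (t : CutTree ((Fin 3 × Fin 3) ⊕ Fin 3) Unit) (c w : (Fin 3 × Fin 3) ⊕ Fin 3 → ℤ),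
      cutOK (fun _ => entryLeafOKHT4A2QQDCRS3 μ) t c w = true → semOKH μ c w = true :=
  cutOK_sound (semOKH μ) (fun _ => entryLeafOKHT4A2QQDCRS3 μ) (fun _ _ _ h => semOKH_of_HT4A2QQDCRS3 h) (fun k u c w hl hr => semOKH_cut k u c w hl hr)

/-- The same at a LOWER level: leaves certified by v3 at `μ₀` give the semantic fact at every `μ ≤ μ₀` (e.g. `muRec` leaves serve `μ₇₈`). [formal bookkeeping] -/
theorem semOKH_of_cutOK_HT4A2QQDCRS3_level {μ μ₀ : ℤ} (hle : μ ≤ μ₀) (t : CutTree ((Fin 3 × Fin 3) ⊕ Fin 3) Unit) (c w : (Fin 3 × Fin 3) ⊕ Fin 3 → ℤ)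
    (h : cutOK (fun _ => entryLeafOKHT4A2QQDCRS3 μ₀) t c w = true) : semOKH μ c w = true :=
  semOKH_mono_level hle (semOKH_of_cutOK_HT4A2QQDCRS3 t c w h)

/-- Kernel-leaf cut trees over the level-closed verdict v4. [formal bookkeeping] -/
theorem semOKH_of_cutOK_HT4A2QQDCRS4 {μ : ℤ} :
    ∀ (t : CutTree ((Fin 3 × Fin 3) ⊕ Fin 3) Unit) (c w : (Fin 3 × Fin 3) ⊕ Fin 3 → ℤ),
      cutOK (fun _ => entryLeafOKHT4A2QQDCRS4 μ) t c w = true → semOKH μ c w = true :=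
  cutOK_sound (semOKH μ) (fun _ => entryLeafOKHT4A2QQDCRS4 μ) (fun _ _ _ h => semOKH_of_HT4A2QQDCRS4 h) (fun k u c w hl hr => semOKH_cut k u c w hl hr)

/-- MIXED LEAVES: a cut tree whose leaf label selects EITHER a listed certified box (`Sum.inl i`: containment in `L[i]`) OR a direct kernel check by v3 at `μ₀ ≥ μ`
(`Sum.inr ()`), so landed cells and freshly drawn cells assemble in one tree. [formal bookkeeping] -/
theorem semOKH_of_cutOK_mixed {μ μ₀ : ℤ} (hle : μ ≤ μ₀) (L : List (((Fin 3 × Fin 3) ⊕ Fin 3 → ℤ) × ((Fin 3 × Fin 3) ⊕ Fin 3 → ℤ)))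
    (hL : ∀ b ∈ L, semOKH μ b.1 b.2 = true) :
    ∀ (t : CutTree ((Fin 3 × Fin 3) ⊕ Fin 3) (ℕ ⊕ Unit)) (c w : (Fin 3 × Fin 3) ⊕ Fin 3 → ℤ),
      cutOK (fun a c w => Sum.elim (fun i => coveredAt L i c w) (fun _ => entryLeafOKHT4A2QQDCRS3 μ₀ c w) a) t c w = true → semOKH μ c w = true :=
  cutOK_sound (semOKH μ) _
    (fun a c w h => by
      rcases a with i | u
      · exact coveredAt_sound (semOKH μ) (fun _ _ _ _ hc h => semOKH_anti_box hc h) L hL i c w h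
      · exact semOKH_mono_level hle (semOKH_of_HT4A2QQDCRS3 h))
    (fun k u c w hl hr => semOKH_cut k u c w hl hr)

/-! ## §4 List plumbing for the manifest facts -/

/-- The empty manifest list is certified. [formal bookkeeping] -/
theorem semFacts_nil {μ : ℤ} : ∀ b ∈ ([] : List (((Fin 3 × Fin 3) ⊕ Fin 3 → ℤ) × ((Fin 3 × Fin 3) ⊕ Fin 3 → ℤ))), semOKH μ b.1 b.2 = true := by
  simp

/-- Cons a landed fact onto a certified manifest list. [formal bookkeeping] -/
theorem semFacts_cons {μ : ℤ} {c w : (Fin 3 × Fin 3) ⊕ Fin 3 → ℤ} {L : List (((Fin 3 × Fin 3) ⊕ Fin 3 → ℤ) × ((Fin 3 × Fin 3) ⊕ Fin 3 → ℤ))}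
    (hb : semOKH μ c w = true) (hL : ∀ b ∈ L, semOKH μ b.1 b.2 = true) : ∀ b ∈ ((c, w) :: L), semOKH μ b.1 b.2 = true := by
  intro b hb'
  rcases List.mem_cons.1 hb' with rfl | h
  · exact hb
  · exact hL b h

/-- Appending two certified manifest lists. [formal bookkeeping] -/
theorem semFacts_append {μ : ℤ} {L₁ L₂ : List (((Fin 3 × Fin 3) ⊕ Fin 3 → ℤ) × ((Fin 3 × Fin 3) ⊕ Fin 3 → ℤ))}
    (h₁ : ∀ b ∈ L₁, semOKH μ b.1 b.2 = true) (h₂ : ∀ b ∈ L₂, semOKH μ b.1 b.2 = true) : ∀ b ∈ L₁ ++ L₂, semOKH μ b.1 b.2 = true := by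
  intro b hb
  rcases List.mem_append.1 hb with h | h
  · exact h₁ b h
  · exact h₂ b h

/-! ## §5 Smoke on production literals: the landed `G70` cell from a 3-leaf cut tree by ONE `decide` -/

/-- Smoke manifest: the landed `G70` cell alone. -/
def smokeL : List (((Fin 3 × Fin 3) ⊕ Fin 3 → ℤ) × ((Fin 3 × Fin 3) ⊕ Fin 3 → ℤ)) := [(cG70, wG70)]

/-- Smoke tree: hand-1's non-midpoint `ξ₁`-cut of the `G70` box (left half-width `u = 495416258234`, cut point `c − w + 2u = −1050570305122`, `…SemanticCells` §3), whose right
piece is cut again along the entry `(U e₀)₀` at left half-width `3`; all three leaves point at `L[0]`. -/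
def smokeT : CutTree ((Fin 3 × Fin 3) ⊕ Fin 3) ℕ :=
  .cut (Sum.inr 1) 495416258234 (.leaf 0) (.cut (Sum.inl (0, 0)) 3 (.leaf 0) (.leaf 0))

/-- The smoke tree has three leaves. [formal bookkeeping] -/
theorem smokeT_leafCount : smokeT.leafCount = 3 := rfl

/-- ★ ONE KERNEL `decide`: the three leaves of the smoke tree partition the `G70` box and each lies in the listed cell. [formal bookkeeping] -/
theorem smokeT_ok : cutOK (coveredAt smokeL) smokeT cG70 wG70 = true := by
  decide

/-- ★ SMOKE: the `G70` semantic fact at `μ₇₈` re-derived through the manifest fold (list fact = hand-1's `sem78_G70`; an `example`, the statement being hand-1's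
`sem78_G70_glued`). [formal bookkeeping] -/
example : semOKH (-399232847967326) cG70 wG70 = true :=
  semOKH_of_cutOK smokeL (semFacts_cons sem78_G70 semFacts_nil) smokeT cG70 wG70 smokeT_ok

/-- The left piece of the smoke is hand-1's literal left piece (`…SemanticCells.sem78_G70_left`): `(k, u)` form and `(a, b)` form agree. [formal bookkeeping] -/
example : Function.update cG70 (Sum.inr 1) (cG70 (Sum.inr 1) - wG70 (Sum.inr 1) + 495416258234) = Function.update cG70 (Sum.inr 1) (-1545986563356) ∧
    Function.update cG70 (Sum.inr 1) (cG70 (Sum.inr 1) + 495416258234) = Function.update cG70 (Sum.inr 1) (-755154046888) ∧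
    Function.update wG70 (Sum.inr 1) (wG70 (Sum.inr 1) - 495416258234) = Function.update wG70 (Sum.inr 1) 295416258234 := by
  refine ⟨?_, ?_, ?_⟩ <;> congr 1

end Summit.AtomisticToContinuum.Crystallization.Theorems.FrustratedLawDichotomyStrainedPatchHomCutTree
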